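import Literature.Analysis.InnerProduct.LensSpaceGeneratingFunction
import HarnessLib

/-!
# Homogeneous three-dimensional lens spaces are spectrally rigid among lens spaces (Ikeda–Yamamoto 1979, Corollary 3.4 with
# Proposition 1.2): if `L(q; p₁, p₂)` with `p₁ ≡ ±p₂ (mod q)` and a lens space `L(q; p₁', p₂')` have the same multiplicities
# `dim E_{k(k+2)}` for every `k`, then `p₁' ≡ ±p₂' (mod q)` — the generating function of a homogeneous space has DOUBLE poles at
# the `q`-th roots of unity `≠ 1`, that of a non-homogeneous one has at most a SIMPLE pole at `γ^{−1}`

Layer `Literature/Analysis/InnerProduct`, namespace `Literature.Analysis.InnerProduct`; lane `lit-hodgefound` (Track 2 foundations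
library), prover seat `lit-hodgefound-p06`, generation 43, self-proposed row g43-#5 — the sequel BY IMPORT of row g43-#4
(`LensSpaceGeneratingFunction.lean`: Theorem 3.2 `tsum_lensMultiplicity_mul_pow`, the generating function `F(z) = ∑_k dim
E_{k(k+2)}z^k = (1/q)∑_{l<q}(1 − z²)/((1 − γ^{p₁l}z)(1 − γ^{−p₁l}z)(1 − γ^{p₂l}z)(1 − γ^{−p₂l}z))` on the unit disc, and Corollary 3.3).
THEOREMS ONLY (no definition, no instance, no notation, no named fact). The printed statement speaks of isometry and homogeneity
of Riemannian manifolds; by the printed Propositions 1.1–1.2 these are ARITHMETIC conditions on `(q; p₁, p₂)`, and the theorem is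
stated and proved here in that arithmetic form, on the tree's multiplicity function `lensMultiplicity q p₁ p₂` (row g43-#2).

## Source, verbatim (held text `paper:doi-10-18910-4811`)

A. Ikeda, Y. Yamamoto, *On the spectra of 3-dimensional lens spaces*, Osaka J. Math. **16** (1979) 447–469: "**Proposition 1.1.**
Let `L(q : p₀, ⋯, p_n)` and `L(q : p'₀, ⋯, p'_n)` be lens spaces. Suppose there exist an integer `l` and numbers `εᵢ ∈ {−1, 1}` …
such that `(p'₀, ⋯, p'_n)` is a permutation of `(ε₀lp₀, ⋯, ε_nlp_n) (mod q)`. Then `L(q : p₀, ⋯, p_n)` is isometric to `L(q : p'₀,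
⋯, p'_n)`. … A riemannian manifold `M` is said to be homogeneous if the isometry group of `M` acts transitively on it.
**Proposition 1.2** (see J.A. Wolf [13]). The riemannian manifold `L(q : p₀, ⋯, p_n)` is homogeneous if and only if for any `i`
and `j`, `0 ≤ i, j ≤ n`, it satisfies either `pᵢ ≡ p_j (mod q)` or `pᵢ ≡ −p_j (mod q)`. Furthermore two homogeneous lens spaces with
same order of fundamental groups are isometric to each other." (p0004); "**Corollary 3.4.** Assume `L(q : p₀, ⋯, p_n)` is a
homogeneous lens space and isospectral to `L(q : p'₀, ⋯, p'_n)`. Then `L(q : p'₀, ⋯, p'_n)` is homogeneous and isometric to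
`L(q : p₀, ⋯, p_n)`. Proof. Let `F(z)` be the generating function associated to the spectrum of `L(q : p₀, ⋯, p_n)`. Then `F(z)`
has a pole of order `(n+1)` or `(2n+1)` at `z =` any `q`-th root of one if and only if for any `i, j (0 ≤ i, j ≤ n)`, we have
either `pᵢ ≡ p_j (mod q)` or `pᵢ ≡ −p_j (mod q)`. By proposition 1.2, this condition holds if and only if `L(q : p₀, ⋯, p_n)` is
homogeneous. By our assumption and Proposition 3.1, the generating function associated to the spectrum of `L(q : p'₀, ⋯, p'_n)`
has also the same condition as `F(z)` so that `L(q : p'₀, ⋯, p'_n)` is homogeneous. By Proposition 1.2, this space is isometric to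
`L(q : p₀, ⋯, p_n)`. q.e.d. REMARK. M. Tanaka [10] obtained Corollary 3.4 for 3-dimensional lens spaces." (p0008); §4: "Choosing
a suitable generator for its defining cyclic group `G`, we may assume `p₀ = 1`." (p0008).

## The proof (n + 1 = 2), as formalised

§1 (Proposition 1.1 at the level of multiplicities, directly from the monomial count (3.2)–(3.3)): `dim E_{k(k+2)}(L(q;p₁,p₂))`
is unchanged under `p₂ ↦ p₂ + tq`, `p₂ ↦ −p₂`, `(p₁,p₂) ↦ (p₂,p₁)` and `(p₁,p₂) ↦ (1, up₂)` when `up₁ ≡ 1`; hence a homogeneous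
`L(q;p₁,p₂)` has the multiplicities of `L(q;1,1)`, and any `L(q;p₁',p₂')` those of `L(q;1,p')`, `p' = u'p₂'`, with `p' ≡ ±1` iff
`p₁' ≡ ±p₂'`. §2–§3 (the pole orders at `z₀ = γ^{−1}`, `γ = e^{2πi/q}`, `q ≥ 3`): a factor `1 − γ^{lp}z` of (3.8) vanishes at `z₀`
iff `q ∣ lp − 1`, a factor `1 − γ^{−lp}z` iff `q ∣ −lp − 1`. For `L(q;1,1)` the terms `l = 1` and `l = q − 1` have exactly two
vanishing factors and `(1 − γz)²T_l(z) → 1/(1 − γ^{−2})`, all other terms none (`→ 0`): `(1 − γz)²F(z) → (2/q)/(1 − γ^{−2}) ≠ 0`. For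
`L(q;1,p')`, `p' ≢ ±1`: any two of the four congruences `l ≡ 1`, `l ≡ −1`, `p'l ≡ 1`, `p'l ≡ −1 (mod q)` force `q ∣ p' ∓ 1` or
`q ∣ 2` — so every term has at most one vanishing factor and `(1 − γz)²E(z) → 0`. §4: with equal multiplicities the two power
series coincide; `z₀` lies in the closure of the disc of convergence, so the limits along `z → z₀`, `|z| < 1`, agree:
contradiction. (`q ≤ 2`: `q ∣ 2` and the conclusion is a parity statement.)

## What is proved

* §1: `lensMonomialCount_congr_right / _swap / _neg_right / _eq_one_left` and the same for **`lensMultiplicity`**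
  (`lensMultiplicity_congr_right`, `lensMultiplicity_swap`, `lensMultiplicity_neg_right`, `lensMultiplicity_eq_one_left`),
  **`lensMultiplicity_eq_one_one_of_homogeneous`** (`p₁ ≡ ±p₂ ⇒` the multiplicities of `L(q;1,1)`).
* §2–§3 (private): `e^{2πiN/q} = 1 ↔ q ∣ N`, the vanishing criteria at `z₀`, the three limit lemmas (no / one / two vanishing
  factors), `tendsto_sq_mul_term_one_one` (the terms of `L(q;1,1)`), `tendsto_sq_mul_term_one` (the terms of `L(q;1,p')`).
* §4: **`tendsto_sq_mul_tsum_lensMultiplicity_one_one`** (`(1 − γz)²F_{L(q;1,1)}(z) → (1/q)·2/(1 − γ^{−2})` along `z → γ^{−1}` in the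
  disc), **`tendsto_sq_mul_tsum_lensMultiplicity_one`** (`→ 0` for `L(q;1,p')`, `p' ≢ ±1`), **`exists_lensMultiplicity_one_one_ne`**
  (`L(q;1,1)` and `L(q;1,p')`, `p' ≢ ±1`, are not isospectral), **`dvd_sub_or_dvd_add_of_lensMultiplicity_eq`** (COROLLARY 3.4,
  `n + 1 = 2`).

## References

* [IkedaYamamoto1979] A. Ikeda, Y. Yamamoto, *On the spectra of 3-dimensional lens spaces*, Osaka J. Math. 16 (1979) 447–469,
  Propositions 1.1, 1.2, Proposition 3.1, Theorem 3.2, Corollary 3.4 and its proof, §4.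
* [Ikeda1980] A. Ikeda, *On lens spaces which are isospectral but not isometric*, Ann. Sci. ÉNS (4) 13 (1980) 303–315 (in dimension
  `≥ 5` the analogue fails: isospectral non-isometric lens spaces exist).
-/

noncomputable section

open Finset Filter Topology Complex

namespace Literature.Analysis.InnerProduct

open _root_.Real _root_.Filter _root_.Topology

/-! ### §1 `dim E_{k(k+2)}(L(q; p₁, p₂))` depends only on `±pᵢ mod q` and is unchanged by a common unit factor:
`L(q; p₁, p₂) = L(q; p₁, p₂ + tq) = L(q; p₁, −p₂) = L(q; 1, p₁*p₂)` at the level of multiplicities (Proposition 1.1) -/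

/-- `dim P_k^G` is unchanged when `p₂` is changed within its class mod `q`. [cite: IkedaYamamoto1979, §1 (lens spaces depend on
`pᵢ mod q`) and §3 (3.2)–(3.3)] -/
theorem lensMonomialCount_congr_right (q : ℕ) (p₁ : ℤ) {p₂ p₂' : ℤ} (h : (q : ℤ) ∣ p₂ - p₂') (k : ℕ) :
    lensMonomialCount q p₁ p₂ k = lensMonomialCount q p₁ p₂' k := by
  unfold lensMonomialCount
  refine sum_congr rfl fun ij _ ↦ sum_congr rfl fun ab _ ↦ sum_congr rfl fun cd _ ↦ if_congr ?_ rfl rfl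
  have e : ((ab.1 : ℤ) - ab.2) * p₁ + ((cd.1 : ℤ) - cd.2) * p₂ =
      ((ab.1 : ℤ) - ab.2) * p₁ + ((cd.1 : ℤ) - cd.2) * p₂' + ((cd.1 : ℤ) - cd.2) * (p₂ - p₂') := by ring
  rw [e]
  exact dvd_add_left (dvd_mul_of_dvd_right h _)

/-- `dim P_k^G` is symmetric in the two weights: `L(q; p₁, p₂)` and `L(q; p₂, p₁)`. [cite: IkedaYamamoto1979, Proposition 1.1] -/
theorem lensMonomialCount_swap (q : ℕ) (p₁ p₂ : ℤ) (k : ℕ) :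
    lensMonomialCount q p₁ p₂ k = lensMonomialCount q p₂ p₁ k := by
  unfold lensMonomialCount
  rw [← Nat.sum_antidiagonal_swap]
  refine sum_congr rfl fun ij _ ↦ ?_
  rw [Prod.fst_swap, Prod.snd_swap, sum_comm]
  refine sum_congr rfl fun cd _ ↦ sum_congr rfl fun ab _ ↦ if_congr ?_ rfl rfl
  rw [add_comm]

/-- `dim P_k^G` is unchanged under `p₂ ↦ −p₂` (the isometry `z₂ ↦ z̄₂` of `S³`, swapping `c ↔ d`).
[cite: IkedaYamamoto1979, Proposition 1.1 (εᵢ = ±1)] -/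
theorem lensMonomialCount_neg_right (q : ℕ) (p₁ p₂ : ℤ) (k : ℕ) :
    lensMonomialCount q p₁ (-p₂) k = lensMonomialCount q p₁ p₂ k := by
  unfold lensMonomialCount
  refine sum_congr rfl fun ij _ ↦ sum_congr rfl fun ab _ ↦ ?_
  rw [← Nat.sum_antidiagonal_swap]
  refine sum_congr rfl fun cd _ ↦ if_congr ?_ rfl rfl
  rw [Prod.fst_swap, Prod.snd_swap, show ((cd.2 : ℤ) - cd.1) * -p₂ = ((cd.1 : ℤ) - cd.2) * p₂ by ring]

/-- `dim P_k^G` is unchanged under a common unit factor: if `up₁ ≡ 1 (mod q)` then `L(q; p₁, p₂)` and `L(q; 1, up₂)` have the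
same invariant monomials (the generator `g` of `G` replaced by `g^u`). [cite: IkedaYamamoto1979, Proposition 1.1 (the integer `l`),
§4 ("we may assume `p₀ = 1`")] -/
theorem lensMonomialCount_eq_one_left (q : ℕ) {p₁ u : ℤ} (hu : (q : ℤ) ∣ u * p₁ - 1) (p₂ : ℤ) (k : ℕ) :
    lensMonomialCount q p₁ p₂ k = lensMonomialCount q 1 (u * p₂) k := by
  unfold lensMonomialCount
  refine sum_congr rfl fun ij _ ↦ sum_congr rfl fun ab _ ↦ sum_congr rfl fun cd _ ↦ if_congr ?_ rfl rfl
  set A : ℤ := (ab.1 : ℤ) - ab.2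
  set C : ℤ := (cd.1 : ℤ) - cd.2
  constructor
  · intro h
    have e : A * 1 + C * (u * p₂) = u * (A * p₁ + C * p₂) - A * (u * p₁ - 1) := by ring
    rw [e]
    exact dvd_sub (dvd_mul_of_dvd_right h _) (dvd_mul_of_dvd_right hu _)
  · intro h
    have e : A * p₁ + C * p₂ = p₁ * (A * 1 + C * (u * p₂)) - C * p₂ * (u * p₁ - 1) := by ring
    rw [e]
    exact dvd_sub (dvd_mul_of_dvd_right h _) (dvd_mul_of_dvd_right hu _)

/-- The multiplicities of `L(q; p₁, p₂)` depend only on `p₂ mod q`. [cite: IkedaYamamoto1979, §1] -/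
theorem lensMultiplicity_congr_right (q : ℕ) (p₁ : ℤ) {p₂ p₂' : ℤ} (h : (q : ℤ) ∣ p₂ - p₂') (k : ℕ) :
    lensMultiplicity q p₁ p₂ k = lensMultiplicity q p₁ p₂' k := by
  simp only [lensMultiplicity, lensMonomialCount_congr_right q p₁ h]

/-- `L(q; p₁, p₂)` and `L(q; p₂, p₁)` have the same multiplicities. [cite: IkedaYamamoto1979, Proposition 1.1] -/
theorem lensMultiplicity_swap (q : ℕ) (p₁ p₂ : ℤ) (k : ℕ) :
    lensMultiplicity q p₁ p₂ k = lensMultiplicity q p₂ p₁ k := by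
  simp only [lensMultiplicity, lensMonomialCount_swap q p₁ p₂]

/-- `L(q; p₁, −p₂)` and `L(q; p₁, p₂)` have the same multiplicities. [cite: IkedaYamamoto1979, Proposition 1.1] -/
theorem lensMultiplicity_neg_right (q : ℕ) (p₁ p₂ : ℤ) (k : ℕ) :
    lensMultiplicity q p₁ (-p₂) k = lensMultiplicity q p₁ p₂ k := by
  simp only [lensMultiplicity, lensMonomialCount_neg_right q p₁ p₂]

/-- `L(q; p₁, p₂)` and `L(q; 1, up₂)`, `up₁ ≡ 1 (mod q)`, have the same multiplicities ("we may assume `p₀ = 1`").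
[cite: IkedaYamamoto1979, Proposition 1.1, §4] -/
theorem lensMultiplicity_eq_one_left (q : ℕ) {p₁ u : ℤ} (hu : (q : ℤ) ∣ u * p₁ - 1) (p₂ : ℤ) (k : ℕ) :
    lensMultiplicity q p₁ p₂ k = lensMultiplicity q 1 (u * p₂) k := by
  simp only [lensMultiplicity, lensMonomialCount_eq_one_left q hu p₂]

/-- **A homogeneous three-dimensional lens space has the multiplicities of `L(q; 1, 1)`**: if `p₁ ≡ ±p₂ (mod q)` (Proposition 1.2:
`L(q; p₁, p₂)` homogeneous) and `p₁` is prime to `q`, then `dim E_{k(k+2)}(L(q;p₁,p₂)) = dim E_{k(k+2)}(L(q;1,1))` for every `k`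
("two homogeneous lens spaces with same order of fundamental groups are isometric to each other").
[cite: IkedaYamamoto1979, Proposition 1.2] -/
theorem lensMultiplicity_eq_one_one_of_homogeneous (q : ℕ) {p₁ p₂ : ℤ} (hp₁ : IsCoprime p₁ q)
    (h : (q : ℤ) ∣ p₁ - p₂ ∨ (q : ℤ) ∣ p₁ + p₂) (k : ℕ) :
    lensMultiplicity q p₁ p₂ k = lensMultiplicity q 1 1 k := by
  obtain ⟨u, v, huv⟩ := hp₁
  have hu : (q : ℤ) ∣ u * p₁ - 1 := ⟨-v, by linear_combination huv⟩
  rw [lensMultiplicity_eq_one_left q hu]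
  rcases h with h | h
  · -- `up₂ ≡ up₁ ≡ 1`
    exact lensMultiplicity_congr_right q 1 (p₂ := u * p₂) (p₂' := 1)
      (by have e : u * p₂ - 1 = (u * p₁ - 1) - u * (p₁ - p₂) := by ring
          rw [e]; exact dvd_sub hu (dvd_mul_of_dvd_right h _)) k
  · -- `up₂ ≡ −up₁ ≡ −1`
    rw [← lensMultiplicity_neg_right q 1 1]
    exact lensMultiplicity_congr_right q 1 (p₂ := u * p₂) (p₂' := -1)
      (by have e : u * p₂ - -1 = u * (p₁ + p₂) - (u * p₁ - 1) := by ring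
          rw [e]; exact dvd_sub (dvd_mul_of_dvd_right h _) hu) k

/-! ### §2 At the `q`-th root of unity `z₀ = γ^{−1}`: which factors `1 − γ^{±pl}z` of (3.8) vanish, and the limits of
`(1 − γz)²·(1 − z²)/∏(1 − ωz)` as `z → z₀` -/

/-- `0 < N < q ⇒ q ∤ N`. [folklore] -/
private theorem not_dvd_of_pos_of_lt {q : ℕ} {N : ℤ} (h0 : 0 < N) (h1 : N < q) : ¬ (q : ℤ) ∣ N := by
  rintro ⟨c, hc⟩
  rcases le_or_gt c 0 with hc0 | hc0
  · nlinarith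
  · nlinarith

/-- `e^{2πiN/q} = 1 ↔ q ∣ N`. [folklore] -/
private theorem exp_two_pi_mul_I_mul_intCast_div_eq_one_iff {q : ℕ} (hq : q ≠ 0) (N : ℤ) :
    cexp (2 * π * I * N / q) = 1 ↔ (q : ℤ) ∣ N := by
  have hq0 : (q : ℂ) ≠ 0 := Nat.cast_ne_zero.mpr hq
  have h2 : (2 * π * I : ℂ) ≠ 0 := by simp [Real.pi_ne_zero, I_ne_zero]
  constructor
  · intro h
    obtain ⟨n, hn⟩ := Complex.exp_eq_one_iff.mp h
    have h3 := congrArg (· * (q : ℂ)) hn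
    simp only [div_mul_cancel₀ _ hq0] at h3
    have h4 : (2 * π * I) * (N : ℂ) = (2 * π * I) * (n * q) := by linear_combination h3
    have h5 := mul_left_cancel₀ h2 h4
    exact ⟨n, by exact_mod_cast h5.trans (mul_comm _ _)⟩
  · rintro ⟨c, hc⟩
    rw [hc, show (2 * π * I * ((q * c : ℤ) : ℂ) / q) = c * (2 * π * I) by push_cast; field_simp]
    exact Complex.exp_int_mul_two_pi_mul_I c

/-- `γ^{lp}·γ^{−1} = 1 ↔ q ∣ lp − 1`: the factor `1 − γ^{lp}z` of (3.8) vanishes at `z₀ = γ^{−1}` iff `lp ≡ 1 (mod q)`. [folklore] -/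
private theorem exp_mul_exp_neg_eq_one_iff {q : ℕ} (hq : q ≠ 0) (l : ℕ) (p : ℤ) :
    cexp (2 * π * I * l * p / q) * cexp (-(2 * π * I / q)) = 1 ↔ (q : ℤ) ∣ l * p - 1 := by
  rw [← Complex.exp_add, show 2 * π * I * (l : ℂ) * (p : ℂ) / q + -(2 * π * I / q) =
    2 * π * I * ((((l : ℤ) * p - 1 : ℤ)) : ℂ) / q by push_cast; ring]
  exact exp_two_pi_mul_I_mul_intCast_div_eq_one_iff hq _

/-- `γ^{−lp}·γ^{−1} = 1 ↔ q ∣ −lp − 1`: the factor `1 − γ^{−lp}z` vanishes at `z₀ = γ^{−1}` iff `lp ≡ −1 (mod q)`. [folklore] -/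
private theorem exp_neg_mul_exp_neg_eq_one_iff {q : ℕ} (hq : q ≠ 0) (l : ℕ) (p : ℤ) :
    cexp (-(2 * π * I * l * p / q)) * cexp (-(2 * π * I / q)) = 1 ↔ (q : ℤ) ∣ -(l * p) - 1 := by
  rw [← Complex.exp_add, show -(2 * π * I * (l : ℂ) * (p : ℂ) / q) + -(2 * π * I / q) =
    2 * π * I * (((-((l : ℤ) * p) - 1 : ℤ)) : ℂ) / q by push_cast; ring]
  exact exp_two_pi_mul_I_mul_intCast_div_eq_one_iff hq _

/-- `γ·γ^{−1} = 1`. [folklore] -/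
private theorem exp_mul_exp_neg_self (q : ℕ) : cexp (2 * π * I / q) * cexp (-(2 * π * I / q)) = 1 := by
  rw [← Complex.exp_add, add_neg_cancel, Complex.exp_zero]

/-- If `ωz₀ = 1 = γz₀` then `ω = γ`. [folklore] -/
private theorem eq_of_mul_eq_one_of_mul_eq_one {ω γ z₀ : ℂ} (hω : ω * z₀ = 1) (hγ : γ * z₀ = 1) : ω = γ := by
  have hz : z₀ ≠ 0 := by
    rintro rfl
    simp at hγ
  exact mul_right_cancel₀ hz (hω.trans hγ.symm)

/-- `γz₀ = 1`, `z ≠ z₀ ⇒ 1 − γz ≠ 0`. [folklore] -/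
private theorem one_sub_mul_ne_zero_of_ne {γ z₀ z : ℂ} (hγ : γ * z₀ = 1) (hz : z ≠ z₀) : 1 - γ * z ≠ 0 := by
  intro h
  apply hz
  have hγ0 : γ ≠ 0 := by
    rintro rfl
    simp at hγ
  exact mul_left_cancel₀ hγ0 ((sub_eq_zero.mp h).symm.trans hγ.symm)

/-- **No factor vanishes at `z₀`**: `(1 − γz)²·(1 − z²)/D(z) → 0` as `z → z₀` when `D` is continuous with `D(z₀) ≠ 0`. [folklore] -/
private theorem tendsto_sq_mul_div_of_ne_zero {γ z₀ : ℂ} (hγ : γ * z₀ = 1) {D : ℂ → ℂ} (hD : ContinuousAt D z₀)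
    (hD0 : D z₀ ≠ 0) :
    Tendsto (fun z : ℂ ↦ (1 - γ * z) ^ 2 * ((1 - z ^ 2) / D z)) (𝓝[≠] z₀) (𝓝 0) := by
  have h1 : Tendsto (fun z : ℂ ↦ (1 - γ * z) ^ 2) (𝓝 z₀) (𝓝 ((1 - γ * z₀) ^ 2)) :=
    (tendsto_const_nhds.sub (tendsto_const_nhds.mul tendsto_id)).pow 2
  rw [hγ, sub_self, zero_pow two_ne_zero] at h1
  have h2 : Tendsto (fun z : ℂ ↦ (1 - z ^ 2) / D z) (𝓝 z₀) (𝓝 ((1 - z₀ ^ 2) / D z₀)) :=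
    (tendsto_const_nhds.sub (tendsto_id.pow 2)).div hD.tendsto hD0
  have h3 := h1.mul h2
  rw [zero_mul] at h3
  exact h3.mono_left nhdsWithin_le_nhds

/-- **Exactly one factor vanishes at `z₀`** (a simple pole of the term): `(1 − γz)²·(1 − z²)/((1 − γz)R(z)) → 0`. [folklore] -/
private theorem tendsto_sq_mul_div_of_one {γ z₀ : ℂ} (hγ : γ * z₀ = 1) {D R : ℂ → ℂ}
    (hDR : ∀ z, D z = (1 - γ * z) * R z) (hR : ContinuousAt R z₀) (hR0 : R z₀ ≠ 0) :
    Tendsto (fun z : ℂ ↦ (1 - γ * z) ^ 2 * ((1 - z ^ 2) / D z)) (𝓝[≠] z₀) (𝓝 0) := by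
  have h1 : Tendsto (fun z : ℂ ↦ 1 - γ * z) (𝓝 z₀) (𝓝 (1 - γ * z₀)) :=
    tendsto_const_nhds.sub (tendsto_const_nhds.mul tendsto_id)
  rw [hγ, sub_self] at h1
  have h2 : Tendsto (fun z : ℂ ↦ (1 - z ^ 2) / R z) (𝓝 z₀) (𝓝 ((1 - z₀ ^ 2) / R z₀)) :=
    (tendsto_const_nhds.sub (tendsto_id.pow 2)).div hR.tendsto hR0
  have h3 := (h1.mul h2).mono_left (nhdsWithin_le_nhds (s := {z₀}ᶜ))
  rw [zero_mul] at h3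
  refine h3.congr' ?_
  filter_upwards [self_mem_nhdsWithin, mem_nhdsWithin_of_mem_nhds (hR.eventually_ne hR0)] with z hz hRz
  have hz' := one_sub_mul_ne_zero_of_ne hγ hz
  have hz'' : 1 - z * γ ≠ 0 := by rwa [mul_comm] at hz'
  rw [hDR z]
  field_simp

/-- **Exactly two factors vanish at `z₀`** (a double pole of the term): `(1 − γz)²·(1 − z²)/((1 − γz)²R(z)) → (1 − z₀²)/R(z₀)`.
[folklore] -/
private theorem tendsto_sq_mul_div_of_two {γ z₀ : ℂ} (hγ : γ * z₀ = 1) {D R : ℂ → ℂ}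
    (hDR : ∀ z, D z = (1 - γ * z) * (1 - γ * z) * R z) (hR : ContinuousAt R z₀) (hR0 : R z₀ ≠ 0) :
    Tendsto (fun z : ℂ ↦ (1 - γ * z) ^ 2 * ((1 - z ^ 2) / D z)) (𝓝[≠] z₀) (𝓝 ((1 - z₀ ^ 2) / R z₀)) := by
  have h2 : Tendsto (fun z : ℂ ↦ (1 - z ^ 2) / R z) (𝓝 z₀) (𝓝 ((1 - z₀ ^ 2) / R z₀)) :=
    (tendsto_const_nhds.sub (tendsto_id.pow 2)).div hR.tendsto hR0
  refine (h2.mono_left nhdsWithin_le_nhds).congr' ?_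
  filter_upwards [self_mem_nhdsWithin, mem_nhdsWithin_of_mem_nhds (hR.eventually_ne hR0)] with z hz hRz
  have hz' := one_sub_mul_ne_zero_of_ne hγ hz
  have hz'' : 1 - z * γ ≠ 0 := by rwa [mul_comm] at hz'
  rw [hDR z]
  field_simp

/-! ### §3 The homogeneous space `L(q; 1, 1)` has DOUBLE poles at `z₀ = γ^{−1}` (terms `l = 1`, `l = q−1`); a non-homogeneous
`L(q; 1, p)`, `p ≢ ±1`, has at most SIMPLE poles there -/

/-- `1 − γ^{−2} ≠ 0` for `q ≥ 3`. [folklore] -/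
private theorem one_sub_exp_neg_sq_ne_zero {q : ℕ} (hq : 3 ≤ q) : 1 - cexp (-(2 * π * I / q)) ^ 2 ≠ 0 := by
  have hq0 : q ≠ 0 := by omega
  intro h
  have h1 : cexp (-(2 * π * I / q)) ^ 2 = 1 := (sub_eq_zero.mp h).symm
  rw [sq, ← Complex.exp_add, show -(2 * π * I / (q : ℂ)) + -(2 * π * I / q) = 2 * π * I * ((-2 : ℤ) : ℂ) / q by
    push_cast; ring, exp_two_pi_mul_I_mul_intCast_div_eq_one_iff hq0, dvd_neg] at h1
  exact not_dvd_of_pos_of_lt two_pos (by omega) h1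

/-- **The terms of (3.8) for `L(q; 1, 1)` at `z₀ = γ^{−1}`** (`q ≥ 3`, `l < q`): `(1 − γz)²·T_l(z) → 1/(1 − γ^{−2})` for
`l = 1` and `l = q − 1` (the factors `(1 − γ^{l}z)(1 − γ^{l}z)`, resp. `(1 − γ^{−l}z)(1 − γ^{−l}z)`, give a double pole), and `→ 0`
for every other `l` (no factor vanishes). [cite: IkedaYamamoto1979, proof of Corollary 3.4 ("a pole of order `(n+1)` … at any
`q`-th root of one … if and only if … `pᵢ ≡ ±p_j`")] -/
private theorem tendsto_sq_mul_term_one_one {q : ℕ} (hq : 3 ≤ q) {l : ℕ} (hl : l < q) :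
    Tendsto (fun z : ℂ ↦ (1 - cexp (2 * π * I / q) * z) ^ 2 * ((1 - z ^ 2) /
      ((1 - cexp (2 * π * I * l * ((1 : ℤ) : ℂ) / q) * z) * (1 - cexp (-(2 * π * I * l * ((1 : ℤ) : ℂ) / q)) * z) *
        ((1 - cexp (2 * π * I * l * ((1 : ℤ) : ℂ) / q) * z) * (1 - cexp (-(2 * π * I * l * ((1 : ℤ) : ℂ) / q)) * z)))))
      (𝓝[≠] (cexp (-(2 * π * I / q))))
      (𝓝 (if l = 1 ∨ l = q - 1 then 1 / (1 - cexp (-(2 * π * I / q)) ^ 2) else 0)) := by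
  have hq0 : q ≠ 0 := by omega
  have hγ := exp_mul_exp_neg_self q
  have hV := one_sub_exp_neg_sq_ne_zero hq
  have hV' : 1 - cexp (-(2 * π * I / q)) * cexp (-(2 * π * I / q)) ≠ 0 := by rwa [← sq]
  have hVeq : 1 / (1 - cexp (-(2 * π * I / q)) ^ 2) = (1 - cexp (-(2 * π * I / q)) ^ 2) /
      ((1 - cexp (-(2 * π * I / q)) * cexp (-(2 * π * I / q))) * (1 - cexp (-(2 * π * I / q)) * cexp (-(2 * π * I / q)))) := by
    rw [← sq]
    field_simp
  rcases eq_or_ne l 1 with rfl | hl1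
  · -- `l = 1`: the factors `1 − γz` (twice)
    rw [if_pos (Or.inl rfl), hVeq]
    simp only [Nat.cast_one, Int.cast_one, mul_one]
    exact tendsto_sq_mul_div_of_two hγ (D := fun z ↦ (1 - cexp (2 * π * I / q) * z) * (1 - cexp (-(2 * π * I / q)) * z) *
        ((1 - cexp (2 * π * I / q) * z) * (1 - cexp (-(2 * π * I / q)) * z)))
      (R := fun z ↦ (1 - cexp (-(2 * π * I / q)) * z) * (1 - cexp (-(2 * π * I / q)) * z)) (fun z ↦ by ring)
      (by fun_prop) (mul_ne_zero hV' hV')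
  rcases eq_or_ne l (q - 1) with rfl | hl2
  · -- `l = q − 1`: `γ^{q−1} = γ^{−1}`, `γ^{−(q−1)} = γ`: the factors `1 − γz` (twice)
    rw [if_pos (Or.inr rfl), hVeq]
    have e3 : cexp (2 * π * I * ((q - 1 : ℕ) : ℂ) * ((1 : ℤ) : ℂ) / q) = cexp (-(2 * π * I / q)) := by
      rw [Complex.exp_eq_exp_iff_exists_int]
      refine ⟨1, ?_⟩
      rw [Nat.cast_sub (by omega), Nat.cast_one, Int.cast_one]
      field_simp
      ring
    have e4 : cexp (-(2 * π * I * ((q - 1 : ℕ) : ℂ) * ((1 : ℤ) : ℂ) / q)) = cexp (2 * π * I / q) := by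
      rw [Complex.exp_eq_exp_iff_exists_int]
      refine ⟨-1, ?_⟩
      rw [Nat.cast_sub (by omega), Nat.cast_one, Int.cast_one, Int.cast_neg, Int.cast_one]
      field_simp
      ring
    simp only [e3, e4]
    exact tendsto_sq_mul_div_of_two hγ (D := fun z ↦ (1 - cexp (-(2 * π * I / q)) * z) * (1 - cexp (2 * π * I / q) * z) *
        ((1 - cexp (-(2 * π * I / q)) * z) * (1 - cexp (2 * π * I / q) * z)))
      (R := fun z ↦ (1 - cexp (-(2 * π * I / q)) * z) * (1 - cexp (-(2 * π * I / q)) * z)) (fun z ↦ by ring)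
      (by fun_prop) (mul_ne_zero hV' hV')
  · -- any other `l`: no factor vanishes at `z₀`
    rw [if_neg (not_or.mpr ⟨hl1, hl2⟩)]
    have n1 : cexp (2 * π * I * l * ((1 : ℤ) : ℂ) / q) * cexp (-(2 * π * I / q)) ≠ 1 := by
      rw [Ne, exp_mul_exp_neg_eq_one_iff hq0]
      rcases Nat.eq_zero_or_pos l with rfl | hl0
      · rw [show ((0 : ℕ) : ℤ) * 1 - 1 = -1 by norm_num, dvd_neg]
        exact not_dvd_of_pos_of_lt one_pos (by omega)
      · exact not_dvd_of_pos_of_lt (by omega) (by omega)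
    have n2 : cexp (-(2 * π * I * l * ((1 : ℤ) : ℂ) / q)) * cexp (-(2 * π * I / q)) ≠ 1 := by
      rw [Ne, exp_neg_mul_exp_neg_eq_one_iff hq0, show -((l : ℤ) * 1) - 1 = -((l : ℤ) + 1) by ring, dvd_neg]
      exact not_dvd_of_pos_of_lt (by omega) (by omega)
    exact tendsto_sq_mul_div_of_ne_zero hγ (D := fun z ↦ (1 - cexp (2 * π * I * l * ((1 : ℤ) : ℂ) / q) * z) *
        (1 - cexp (-(2 * π * I * l * ((1 : ℤ) : ℂ) / q)) * z) * ((1 - cexp (2 * π * I * l * ((1 : ℤ) : ℂ) / q) * z) *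
          (1 - cexp (-(2 * π * I * l * ((1 : ℤ) : ℂ) / q)) * z))) (by fun_prop)
      (mul_ne_zero (mul_ne_zero (sub_ne_zero.mpr n1.symm) (sub_ne_zero.mpr n2.symm))
        (mul_ne_zero (sub_ne_zero.mpr n1.symm) (sub_ne_zero.mpr n2.symm)))

/-- **The terms of (3.8) for `L(q; 1, p)`, `p ≢ ±1 (mod q)`, at `z₀ = γ^{−1}`** (`q ≥ 3`): at most ONE of the four factors
`1 − γ^{±l}z`, `1 − γ^{±pl}z` vanishes at `z₀` (two of the congruences `l ≡ 1`, `l ≡ −1`, `pl ≡ 1`, `pl ≡ −1` together force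
`p ≡ ±1` or `q ∣ 2`), so `(1 − γz)²·T_l(z) → 0`. [cite: IkedaYamamoto1979, proof of Corollary 3.4] -/
private theorem tendsto_sq_mul_term_one {q : ℕ} (hq : 3 ≤ q) {p : ℤ} (hp1 : ¬ (q : ℤ) ∣ p - 1) (hp2 : ¬ (q : ℤ) ∣ p + 1)
    (l : ℕ) :
    Tendsto (fun z : ℂ ↦ (1 - cexp (2 * π * I / q) * z) ^ 2 * ((1 - z ^ 2) /
      ((1 - cexp (2 * π * I * l * ((1 : ℤ) : ℂ) / q) * z) * (1 - cexp (-(2 * π * I * l * ((1 : ℤ) : ℂ) / q)) * z) *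
        ((1 - cexp (2 * π * I * l * (p : ℂ) / q) * z) * (1 - cexp (-(2 * π * I * l * (p : ℂ) / q)) * z)))))
      (𝓝[≠] (cexp (-(2 * π * I / q)))) (𝓝 0) := by
  have hq0 : q ≠ 0 := by omega
  have hq2 : ¬ (q : ℤ) ∣ 2 := not_dvd_of_pos_of_lt two_pos (by omega)
  have hγ := exp_mul_exp_neg_self q
  -- the four vanishing conditions and their pairwise incompatibility
  have k1 := exp_mul_exp_neg_eq_one_iff hq0 l 1
  have k2 := exp_neg_mul_exp_neg_eq_one_iff hq0 l 1
  have k3 := exp_mul_exp_neg_eq_one_iff hq0 l p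
  have k4 := exp_neg_mul_exp_neg_eq_one_iff hq0 l p
  simp only [Int.cast_one] at k1 k2
  have x12 : (q : ℤ) ∣ l * 1 - 1 → ¬ (q : ℤ) ∣ -(l * 1) - 1 := fun h1 h2 ↦ hq2 (by
    have := dvd_add h1 h2; rw [show (l : ℤ) * 1 - 1 + (-(l * 1) - 1) = -2 by ring, dvd_neg] at this; exact this)
  have x13 : (q : ℤ) ∣ l * 1 - 1 → ¬ (q : ℤ) ∣ l * p - 1 := fun h1 h3 ↦ hp1 (by
    have := dvd_sub h3 (dvd_mul_of_dvd_right h1 p); rw [show (l : ℤ) * p - 1 - p * ((l : ℤ) * 1 - 1) = p - 1 by ring] at this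
    exact this)
  have x14 : (q : ℤ) ∣ l * 1 - 1 → ¬ (q : ℤ) ∣ -(l * p) - 1 := fun h1 h4 ↦ hp2 (by
    have := dvd_add h4 (dvd_mul_of_dvd_right h1 p)
    rw [show -((l : ℤ) * p) - 1 + p * ((l : ℤ) * 1 - 1) = -(p + 1) by ring, dvd_neg] at this
    exact this)
  have x23 : (q : ℤ) ∣ -(l * 1) - 1 → ¬ (q : ℤ) ∣ l * p - 1 := fun h2 h3 ↦ hp2 (by
    have := dvd_add h3 (dvd_mul_of_dvd_right h2 p)
    rw [show (l : ℤ) * p - 1 + p * (-((l : ℤ) * 1) - 1) = -(p + 1) by ring, dvd_neg] at this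
    exact this)
  have x24 : (q : ℤ) ∣ -(l * 1) - 1 → ¬ (q : ℤ) ∣ -(l * p) - 1 := fun h2 h4 ↦ hp1 (by
    have := dvd_sub h4 (dvd_mul_of_dvd_right h2 p)
    rw [show -((l : ℤ) * p) - 1 - p * (-((l : ℤ) * 1) - 1) = p - 1 by ring] at this
    exact this)
  have x34 : (q : ℤ) ∣ l * p - 1 → ¬ (q : ℤ) ∣ -(l * p) - 1 := fun h3 h4 ↦ hq2 (by
    have := dvd_add h3 h4; rw [show (l : ℤ) * p - 1 + (-(l * p) - 1) = -2 by ring, dvd_neg] at this; exact this)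
  -- abbreviations for the four roots of unity
  set ω₁ : ℂ := cexp (2 * π * I * l * ((1 : ℤ) : ℂ) / q) with hω₁
  set ω₂ : ℂ := cexp (-(2 * π * I * l * ((1 : ℤ) : ℂ) / q)) with hω₂
  set ω₃ : ℂ := cexp (2 * π * I * l * (p : ℂ) / q) with hω₃
  set ω₄ : ℂ := cexp (-(2 * π * I * l * (p : ℂ) / q)) with hω₄
  set γ : ℂ := cexp (2 * π * I / q) with hγdef
  set z₀ : ℂ := cexp (-(2 * π * I / q)) with hz₀
  simp only [Int.cast_one] at hω₁ hω₂
  rw [← hω₁] at k1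
  rw [← hω₂] at k2
  by_cases c1 : ω₁ * z₀ = 1
  · have d1 := k1.mp c1
    have n2 : ω₂ * z₀ ≠ 1 := fun h ↦ x12 d1 (k2.mp h)
    have n3 : ω₃ * z₀ ≠ 1 := fun h ↦ x13 d1 (k3.mp h)
    have n4 : ω₄ * z₀ ≠ 1 := fun h ↦ x14 d1 (k4.mp h)
    have e1 := eq_of_mul_eq_one_of_mul_eq_one c1 hγ
    exact tendsto_sq_mul_div_of_one hγ (D := fun z ↦ (1 - ω₁ * z) * (1 - ω₂ * z) * ((1 - ω₃ * z) * (1 - ω₄ * z)))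
      (R := fun z ↦ (1 - ω₂ * z) * ((1 - ω₃ * z) * (1 - ω₄ * z))) (fun z ↦ by rw [e1]; ring) (by fun_prop)
      (mul_ne_zero (sub_ne_zero.mpr n2.symm) (mul_ne_zero (sub_ne_zero.mpr n3.symm) (sub_ne_zero.mpr n4.symm)))
  by_cases c2 : ω₂ * z₀ = 1
  · have d2 := k2.mp c2
    have n3 : ω₃ * z₀ ≠ 1 := fun h ↦ x23 d2 (k3.mp h)
    have n4 : ω₄ * z₀ ≠ 1 := fun h ↦ x24 d2 (k4.mp h)
    have e2 := eq_of_mul_eq_one_of_mul_eq_one c2 hγ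
    exact tendsto_sq_mul_div_of_one hγ (D := fun z ↦ (1 - ω₁ * z) * (1 - ω₂ * z) * ((1 - ω₃ * z) * (1 - ω₄ * z)))
      (R := fun z ↦ (1 - ω₁ * z) * ((1 - ω₃ * z) * (1 - ω₄ * z))) (fun z ↦ by rw [e2]; ring) (by fun_prop)
      (mul_ne_zero (sub_ne_zero.mpr (Ne.symm c1)) (mul_ne_zero (sub_ne_zero.mpr n3.symm) (sub_ne_zero.mpr n4.symm)))
  by_cases c3 : ω₃ * z₀ = 1
  · have d3 := k3.mp c3
    have n4 : ω₄ * z₀ ≠ 1 := fun h ↦ x34 d3 (k4.mp h)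
    have e3 := eq_of_mul_eq_one_of_mul_eq_one c3 hγ
    exact tendsto_sq_mul_div_of_one hγ (D := fun z ↦ (1 - ω₁ * z) * (1 - ω₂ * z) * ((1 - ω₃ * z) * (1 - ω₄ * z)))
      (R := fun z ↦ (1 - ω₁ * z) * (1 - ω₂ * z) * (1 - ω₄ * z)) (fun z ↦ by rw [e3]; ring) (by fun_prop)
      (mul_ne_zero (mul_ne_zero (sub_ne_zero.mpr (Ne.symm c1)) (sub_ne_zero.mpr (Ne.symm c2))) (sub_ne_zero.mpr n4.symm))
  by_cases c4 : ω₄ * z₀ = 1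
  · have e4 := eq_of_mul_eq_one_of_mul_eq_one c4 hγ
    exact tendsto_sq_mul_div_of_one hγ (D := fun z ↦ (1 - ω₁ * z) * (1 - ω₂ * z) * ((1 - ω₃ * z) * (1 - ω₄ * z)))
      (R := fun z ↦ (1 - ω₁ * z) * (1 - ω₂ * z) * (1 - ω₃ * z)) (fun z ↦ by rw [e4]; ring) (by fun_prop)
      (mul_ne_zero (mul_ne_zero (sub_ne_zero.mpr (Ne.symm c1)) (sub_ne_zero.mpr (Ne.symm c2))) (sub_ne_zero.mpr (Ne.symm c3)))
  exact tendsto_sq_mul_div_of_ne_zero hγ (D := fun z ↦ (1 - ω₁ * z) * (1 - ω₂ * z) * ((1 - ω₃ * z) * (1 - ω₄ * z)))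
    (by fun_prop) (mul_ne_zero (mul_ne_zero (sub_ne_zero.mpr (Ne.symm c1)) (sub_ne_zero.mpr (Ne.symm c2)))
      (mul_ne_zero (sub_ne_zero.mpr (Ne.symm c3)) (sub_ne_zero.mpr (Ne.symm c4))))

/-! ### §4 `(1 − γz)²F_{L(q;1,1)}(z) → (2/q)/(1 − γ^{−2}) ≠ 0` but `(1 − γz)²F_{L(q;1,p)}(z) → 0` (`p ≢ ±1`) as `z → γ^{−1}`
inside the unit disc; Corollary 3.4 -/

/-- `|γ^{−1}| = 1`: `z₀` lies on the unit circle, in the closure of the disc of convergence. [folklore] -/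
private theorem norm_exp_neg_two_pi_mul_I_div (q : ℕ) : ‖cexp (-(2 * π * I / q))‖ = 1 := by
  rw [show -(2 * π * I / (q : ℂ)) = ((-(2 * π / q) : ℝ) : ℂ) * I by push_cast; ring, Complex.norm_exp_ofReal_mul_I]

/-- `𝓝[ball 0 1] z₀ ≤ 𝓝[≠] z₀` and `𝓝[ball 0 1] z₀` is nontrivial, for `|z₀| = 1`. [folklore] -/
private theorem nhdsWithin_ball_le_and_neBot {z₀ : ℂ} (hz₀ : ‖z₀‖ = 1) :
    𝓝[Metric.ball (0 : ℂ) 1] z₀ ≤ 𝓝[≠] z₀ ∧ (𝓝[Metric.ball (0 : ℂ) 1] z₀).NeBot := by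
  refine ⟨nhdsWithin_mono _ fun z hz (h1 : z = z₀) ↦ ?_, mem_closure_iff_nhdsWithin_neBot.mp ?_⟩
  · rw [h1, mem_ball_zero_iff, hz₀] at hz
    exact lt_irrefl _ hz
  · rw [closure_ball (0 : ℂ) one_ne_zero, Metric.mem_closedBall, dist_zero_right, hz₀]

/-- **`L(q; 1, 1)` (homogeneous), `q ≥ 3`: `(1 − γz)²·∑_k dim E_{k(k+2)}z^k → (1/q)·2/(1 − γ^{−2})` as `z → γ^{−1}` inside the
unit disc** — a DOUBLE pole of the generating function at `γ^{−1}` ("`F(z)` has a pole of order `(n+1)` … at any `q`-th root of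
one" for a homogeneous lens space). [cite: IkedaYamamoto1979, proof of Corollary 3.4] -/
theorem tendsto_sq_mul_tsum_lensMultiplicity_one_one {q : ℕ} (hq : 3 ≤ q) :
    Tendsto (fun z : ℂ ↦ (1 - cexp (2 * π * I / q) * z) ^ 2 * ∑' k : ℕ, (lensMultiplicity q 1 1 k : ℂ) * z ^ k)
      (𝓝[Metric.ball 0 1] (cexp (-(2 * π * I / q))))
      (𝓝 (1 / (q : ℂ) * (2 * (1 / (1 - cexp (-(2 * π * I / q)) ^ 2))))) := by
  have hq0 : q ≠ 0 := by omega
  -- the closed form, term by term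
  have h := tendsto_finsetSum (range q) fun l hl ↦ tendsto_sq_mul_term_one_one hq (mem_range.mp hl)
  have hsum : ∑ l ∈ range q, (if l = 1 ∨ l = q - 1 then 1 / (1 - cexp (-(2 * π * I / q)) ^ 2) else (0 : ℂ)) =
      2 * (1 / (1 - cexp (-(2 * π * I / q)) ^ 2)) := by
    rw [Finset.sum_ite, Finset.sum_const_zero, add_zero, Finset.sum_const, nsmul_eq_mul]
    have hf : (range q).filter (fun l ↦ l = 1 ∨ l = q - 1) = {1, q - 1} := by
      ext l
      simp only [Finset.mem_filter, Finset.mem_range, Finset.mem_insert, Finset.mem_singleton]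
      omega
    rw [hf, Finset.card_pair (by omega)]
    norm_num
  rw [hsum] at h
  have h' := (h.const_mul (1 / (q : ℂ))).congr (f₂ := fun z : ℂ ↦ (1 - cexp (2 * π * I / q) * z) ^ 2 *
      (1 / (q : ℂ) * ∑ l ∈ range q, (1 - z ^ 2) /
        ((1 - cexp (2 * π * I * l * ((1 : ℤ) : ℂ) / q) * z) * (1 - cexp (-(2 * π * I * l * ((1 : ℤ) : ℂ) / q)) * z) *
          ((1 - cexp (2 * π * I * l * ((1 : ℤ) : ℂ) / q) * z) * (1 - cexp (-(2 * π * I * l * ((1 : ℤ) : ℂ) / q)) * z)))))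
    fun z ↦ by simp only [Finset.mul_sum]; exact Finset.sum_congr rfl fun l _ ↦ by ring
  -- transfer to the power series inside the disc
  obtain ⟨hle, _⟩ := nhdsWithin_ball_le_and_neBot (norm_exp_neg_two_pi_mul_I_div q)
  refine (h'.mono_left hle).congr' ?_
  filter_upwards [self_mem_nhdsWithin] with z hz
  rw [tsum_lensMultiplicity_mul_pow q hq0 1 1 (mem_ball_zero_iff.mp hz)]

/-- **`L(q; 1, p)`, `p ≢ ±1 (mod q)` (non-homogeneous), `q ≥ 3`: `(1 − γz)²·∑_k dim E_{k(k+2)}z^k → 0` as `z → γ^{−1}` inside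
the unit disc** — at most a SIMPLE pole at `γ^{−1}`. [cite: IkedaYamamoto1979, proof of Corollary 3.4] -/
theorem tendsto_sq_mul_tsum_lensMultiplicity_one {q : ℕ} (hq : 3 ≤ q) {p : ℤ} (hp1 : ¬ (q : ℤ) ∣ p - 1)
    (hp2 : ¬ (q : ℤ) ∣ p + 1) :
    Tendsto (fun z : ℂ ↦ (1 - cexp (2 * π * I / q) * z) ^ 2 * ∑' k : ℕ, (lensMultiplicity q 1 p k : ℂ) * z ^ k)
      (𝓝[Metric.ball 0 1] (cexp (-(2 * π * I / q)))) (𝓝 0) := by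
  have hq0 : q ≠ 0 := by omega
  have h := tendsto_finsetSum (range q) fun l (_ : l ∈ range q) ↦ tendsto_sq_mul_term_one hq hp1 hp2 l
  rw [Finset.sum_const_zero] at h
  have h' := (h.const_mul (1 / (q : ℂ))).congr (f₂ := fun z : ℂ ↦ (1 - cexp (2 * π * I / q) * z) ^ 2 *
      (1 / (q : ℂ) * ∑ l ∈ range q, (1 - z ^ 2) /
        ((1 - cexp (2 * π * I * l * ((1 : ℤ) : ℂ) / q) * z) * (1 - cexp (-(2 * π * I * l * ((1 : ℤ) : ℂ) / q)) * z) *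
          ((1 - cexp (2 * π * I * l * (p : ℂ) / q) * z) * (1 - cexp (-(2 * π * I * l * (p : ℂ) / q)) * z)))))
    fun z ↦ by simp only [Finset.mul_sum]; exact Finset.sum_congr rfl fun l _ ↦ by ring
  rw [mul_zero] at h'
  obtain ⟨hle, _⟩ := nhdsWithin_ball_le_and_neBot (norm_exp_neg_two_pi_mul_I_div q)
  refine (h'.mono_left hle).congr' ?_
  filter_upwards [self_mem_nhdsWithin] with z hz
  rw [tsum_lensMultiplicity_mul_pow q hq0 1 p (mem_ball_zero_iff.mp hz)]

/-- **`L(q; 1, 1)` and `L(q; 1, p)` with `p ≢ ±1 (mod q)` are NOT isospectral** (`q ≥ 3`): their multiplicity functions differ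
(the generating functions have poles of different orders at `γ^{−1}`). [cite: IkedaYamamoto1979, Corollary 3.4 and its proof] -/
theorem exists_lensMultiplicity_one_one_ne {q : ℕ} (hq : 3 ≤ q) {p : ℤ} (hp1 : ¬ (q : ℤ) ∣ p - 1) (hp2 : ¬ (q : ℤ) ∣ p + 1) :
    ∃ k : ℕ, lensMultiplicity q 1 1 k ≠ lensMultiplicity q 1 p k := by
  by_contra h
  push Not at h
  have h1 := tendsto_sq_mul_tsum_lensMultiplicity_one_one hq
  have h2 := tendsto_sq_mul_tsum_lensMultiplicity_one hq hp1 hp2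
  simp only [h] at h1
  haveI := (nhdsWithin_ball_le_and_neBot (norm_exp_neg_two_pi_mul_I_div q)).2
  have e := tendsto_nhds_unique h1 h2
  have hq0 : (q : ℂ) ≠ 0 := Nat.cast_ne_zero.mpr (by omega)
  have hV := one_sub_exp_neg_sq_ne_zero hq
  rw [mul_eq_zero, mul_eq_zero] at e
  rcases e with e | e | e
  · exact (div_ne_zero one_ne_zero hq0) e
  · norm_num at e
  · exact (div_ne_zero one_ne_zero hV) e

/-- **COROLLARY 3.4 (Ikeda–Yamamoto 1979) for the three-dimensional lens spaces** ("Assume `L(q : p₀, ⋯, p_n)` is a homogeneous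
lens space and isospectral to `L(q : p'₀, ⋯, p'_n)`. Then `L(q : p'₀, ⋯, p'_n)` is homogeneous and isometric to `L(q : p₀, ⋯,
p_n)`"; M. Tanaka's theorem for homogeneous 3-dimensional lens spaces among lens spaces), in arithmetic form via Proposition 1.2
("`L(q : p₀, ⋯, p_n)` is homogeneous if and only if for any `i` and `j` … either `pᵢ ≡ p_j (mod q)` or `pᵢ ≡ −p_j (mod q)`.
Furthermore two homogeneous lens spaces with same order of fundamental groups are isometric to each other"): if `L(q; p₁, p₂)`
with `p₁ ≡ ±p₂ (mod q)` and the lens space `L(q; p₁', p₂')` (`p₁'`, `p₂'` prime to `q`) have the same multiplicities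
`dim E_{k(k+2)}` for all `k`, then `p₁' ≡ ±p₂' (mod q)`. [cite: IkedaYamamoto1979, Corollary 3.4, Proposition 1.2] -/
theorem dvd_sub_or_dvd_add_of_lensMultiplicity_eq (q : ℕ) {p₁ p₂ p₁' p₂' : ℤ} (hp₁ : IsCoprime p₁ q)
    (hp₁' : IsCoprime p₁' q) (hp₂' : IsCoprime p₂' q) (hhom : (q : ℤ) ∣ p₁ - p₂ ∨ (q : ℤ) ∣ p₁ + p₂)
    (h : ∀ k : ℕ, lensMultiplicity q p₁ p₂ k = lensMultiplicity q p₁' p₂' k) :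
    (q : ℤ) ∣ p₁' - p₂' ∨ (q : ℤ) ∣ p₁' + p₂' := by
  -- small `q`: `q ∣ 2`, and `p₁' ± p₂'` have the right parity
  rcases Nat.lt_or_ge q 3 with hq | hq
  · interval_cases q
    · -- `q = 0`: `IsCoprime p 0` forces `p = ±1`
      have h1 := Int.isUnit_iff.mp (isCoprime_zero_right.mp (by simpa using hp₁'))
      have h2 := Int.isUnit_iff.mp (isCoprime_zero_right.mp (by simpa using hp₂'))
      rcases h1 with h1 | h1 <;> rcases h2 with h2 | h2 <;> simp [h1, h2]
    · exact Or.inl (by simp)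
    · -- `q = 2`: both weights are odd
      left
      have hodd : ∀ {p : ℤ}, IsCoprime p (2 : ℕ) → Odd p := fun {p} hp ↦ by
        rw [← Int.not_even_iff_odd, even_iff_two_dvd]
        rintro ⟨c, rfl⟩
        obtain ⟨x, y, hxy⟩ := hp
        have : (2 : ℤ) ∣ 1 := ⟨x * c + y, by push_cast at hxy; linear_combination -hxy⟩
        omega
      have := (hodd hp₁').sub_odd (hodd hp₂')
      exact_mod_cast even_iff_two_dvd.mp this
  -- `q ≥ 3`: reduce to `L(q;1,1)` versus `L(q;1,u'p₂')`
  obtain ⟨u', v', huv'⟩ := hp₁'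
  have hu' : (q : ℤ) ∣ u' * p₁' - 1 := ⟨-v', by linear_combination huv'⟩
  have hcop : IsCoprime (q : ℤ) u' := ⟨v', p₁', by linear_combination huv'⟩
  have hred : ∀ k : ℕ, lensMultiplicity q 1 1 k = lensMultiplicity q 1 (u' * p₂') k := fun k ↦ by
    rw [← lensMultiplicity_eq_one_one_of_homogeneous q hp₁ hhom k, h k, lensMultiplicity_eq_one_left q hu' p₂' k]
  by_contra hne
  rcases not_or.mp hne with ⟨hne1, hne2⟩
  have hp1 : ¬ (q : ℤ) ∣ u' * p₂' - 1 := fun hd ↦ hne1 (by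
    have : (q : ℤ) ∣ (p₁' - p₂') * u' := by
      rw [show (p₁' - p₂') * u' = (u' * p₁' - 1) - (u' * p₂' - 1) by ring]
      exact dvd_sub hu' hd
    exact hcop.dvd_of_dvd_mul_right this)
  have hp2 : ¬ (q : ℤ) ∣ u' * p₂' + 1 := fun hd ↦ hne2 (by
    have : (q : ℤ) ∣ (p₁' + p₂') * u' := by
      rw [show (p₁' + p₂') * u' = (u' * p₁' - 1) + (u' * p₂' + 1) by ring]
      exact dvd_add hu' hd
    exact hcop.dvd_of_dvd_mul_right this)
  obtain ⟨k, hk⟩ := exists_lensMultiplicity_one_one_ne hq hp1 hp2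
  exact hk (hred k)

end Literature.Analysis.InnerProduct
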